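import Literature.AnabelianGeometry.SemiGraphs.TemperedFixedGeodesicsBounded
import Literature.AnabelianGeometry.SemiGraphs.TreeSystemBoundedGeodesicsDichotomy
import Literature.AnabelianGeometry.SemiGraphs.TreeFixedSubjointSystemKill
import Literature.AnabelianGeometry.SemiGraphs.TemperedTreeBranchPairEstrangement
import Literature.AnabelianGeometry.SemiGraphs.TemperedPiVerticialLevelData
import Literature.AnabelianGeometry.SemiGraphs.TemperedPiLevelsConnected
import HarnessLib

/-!
# [SemiAnbd] Thm. 3.7 (iii) beyond finite semi-graphs: the adjacency clause of (FIX∞) at bounded distance, assembled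

Mochizuki, *Semi-graphs of anabelioids*, Publ. RIMS **42** (2006), §3, Theorem 3.7 (iii), manuscript
p. 41 [cite: MochizukiSemiAnbd2006, Thm 3.7(iii) p.41], with the author's *Comments* (2020) (6).

PROOF-ONLY assembly (cell abc-iut, layer L3, GAP row G-t6g3-2 «Thm 3.7 (iii)/Cor 3.9 beyond finite 𝒢»,
sub-row E2-bounded; seat abc-iut-L3-t10; no definition).  The closers
`compactInVerticialAt_of_fixedSystems` / `cor39UpToTwistAt_of_fixedSystems`
(`TemperedCompactInVerticialAtOfFixedSystems.lean`) take the input (FIX∞) = (`hfix`, `hadj`) on the level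
data of a chart.  The second clause `hadj` («two compatible `C`-fixed vertex systems that differ at a
level are joined there by a `C`-fixed edge») is proved here for pairs at BOUNDED subdivision distance,
from LEVEL-structure inputs only — no finiteness of `𝒢` or of the levels:

* `VerticialLevelData.hadj_of_bounded_dist_of_levelEstranged` — from the level branch-pair
  estrangement hypothesis (`hnobp` at the levels under the trees, the output of
  `noFixedBranchPairSystem_of_isTotallyEstranged_cpt`): abc-iut-w5-d160's dichotomy
  `SemiGraph.adjacent_or_exists_fixedBranchPairSystem_of_bounded_dist` (adjacent, or a compatible
  `C`-fixed subjoint system of the trees) followed by the kill `SemiGraph.eq_bot_of_fixedSubjointSystem`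
  (the tree system pushes down along the immersions `quot`);
* `VerticialLevelData.hadj_of_bounded_dist_of_stabBranchPairCpt_level` — from the compact-form
  branch-level identification (I4′)_cpt at the levels (`stabC`): abc-iut-w4-d080's
  `noFixedTreeBranchPairSystem_of_stabBranchPairCpt_level` gives the tree-level `hnobp`, and
  abc-iut-w5-d160's `VerticialLevelData.hadj_of_bounded_dist` concludes;
* `hadj_temperedPiChart_of_bounded_dist` — the instance at the CANONICAL data
  `verticialLevelData_temperedPiChart h36` of the constructed chart (levels = the orbit graphs of the
  Galois tower, `treeQuot` the universal graph-coverings, `levelAct`, `levelTrans`), modulo (I4′)_cpt at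
  those levels as a binder (`stabC`; it is abc-iut-L3-t11's `GaloisLevelData.stabBranchPairCpt'_ofTower'`,
  landing behind `GaloisTowerBranchSystems`).

Hence, for ANY countable `𝒢`, the `Hadj` binder of `compactInVerticialAt_of_fixedSystems` is
discharged for every pair of compatible `C`-fixed systems whose level distances stay bounded; the
unbounded case and the existence clause `hfix` are the open sub-row G-t6g3-2b (abc-iut-L3-t10's memo
`SHAPES-Ggt6g32.md` §(f)).  Test case `𝒢⋆` (abc-iut-w4-d075): a compact `H = ⟨x⟩ ≠ 1` there has a
single compatible fixed system, so the hypotheses are never met and nothing false is asserted.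

Nothing here takes a side on [IUTchIII] Cor. 3.12.
-/

namespace Literature.AnabelianGeometry.SemiGraphs

namespace ProfiniteSemiGraph

open CategoryTheory Topology

universe v u

variable {𝒢 : ProfiniteSemiGraph.{u}}

namespace VerticialLevelData

variable {c : TemperedPiChart 𝒢} (D : VerticialLevelData.{v} 𝒢 c)

/-- **`hadj` at bounded distance from LEVEL estrangement** ([SemiAnbd] Thm. 3.7 (iii), p. 41, the
"single [closed] edge" joining two fixed vertices): let the trees `D.tree j` cover levels `level j`
through equivariant immersions `quot j` compatible with the transitions, and suppose no nontrivial
subgroup `C` fixes a compatible branch-pair system of the LEVELS (`hnobp`, total estrangement in the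
form produced by `noFixedBranchPairSystem_of_isTotallyEstranged_cpt`).  Then for `C ≠ ⊥` and compatible
`C`-fixed vertex systems `x`, `x'` at bounded subdivision distance, at every level with `x j ≠ x' j`
the two vertices are joined by a `C`-fixed edge: either they are (dichotomy
`SemiGraph.adjacent_or_exists_fixedBranchPairSystem_of_bounded_dist`), or `C` fixes a compatible
subjoint system of the trees, which pushes down along `quot` and contradicts `hnobp`
(`SemiGraph.eq_bot_of_fixedSubjointSystem`).  No finiteness of the levels.
[cite: MochizukiSemiAnbd2006, Thm 3.7(iii) p.41] -/
theorem hadj_of_bounded_dist_of_levelEstranged (C : Subgroup c.G) (hC : C ≠ ⊥)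
    (level : D.J → SemiGraph.{u}) (quot : ∀ j, D.tree j ⟶ level j)
    (quot_isImmersion : ∀ j, SemiGraph.IsImmersion (quot j)) (levelAct : ∀ j, c.G →* Aut (level j))
    (act_quot : ∀ (j : D.J) (g : c.G), (D.act j g).hom ≫ quot j = quot j ≫ (levelAct j g).hom)
    (levelTrans : ∀ ⦃i j : D.J⦄, i ≤ j → (level j ⟶ level i))
    (trans_quot : ∀ ⦃i j : D.J⦄ (h : i ≤ j), D.trans h ≫ quot i = quot j ≫ levelTrans h)
    (hnobp : ∀ (j₀ : D.J) (w : ∀ i : {i : D.J // j₀ ≤ i}, (level i.1).Vertex)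
      (β β' : ∀ i : {i : D.J // j₀ ≤ i}, (level i.1).Branch),
      (∀ i, β i ≠ β' i ∧ (level i.1).abuts (β i) = some (w i) ∧ (level i.1).abuts (β' i) = some (w i)) →
      (∀ ⦃i i' : {i : D.J // j₀ ≤ i}⦄ (h : i.1 ≤ i'.1), (levelTrans h).vertexMap (w i') = w i ∧
        (levelTrans h).branchMap (β i') = β i ∧ (levelTrans h).branchMap (β' i') = β' i) →
      (∀ (i : {i : D.J // j₀ ≤ i}) (γ : C), (levelAct i.1 γ).hom.vertexMap (w i) = w i ∧
        (levelAct i.1 γ).hom.branchMap (β i) = β i ∧ (levelAct i.1 γ).hom.branchMap (β' i) = β' i) →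
      C = ⊥)
    (x x' : ∀ j, (D.tree j).Vertex)
    (hx : ∀ ⦃i j : D.J⦄ (h : i ≤ j), (D.trans h).vertexMap (x j) = x i)
    (hx' : ∀ ⦃i j : D.J⦄ (h : i ≤ j), (D.trans h).vertexMap (x' j) = x' i)
    (hfx : ∀ g ∈ C, ∀ j, (D.act j g).hom.vertexMap (x j) = x j)
    (hfx' : ∀ g ∈ C, ∀ j, (D.act j g).hom.vertexMap (x' j) = x' j)
    (hbdd : ∃ N : ℕ, ∀ j, (D.tree j).subdivision.dist (Sum.inl (x j)) (Sum.inl (x' j)) ≤ N)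
    (j : D.J) (hne : x j ≠ x' j) :
    ∃ (e : (D.tree j).Edge) (b b' : (D.tree j).Branch), b ≠ b' ∧
      (D.tree j).edgeOf b = e ∧ (D.tree j).edgeOf b' = e ∧ (D.tree j).abuts b = some (x j) ∧
      (D.tree j).abuts b' = some (x' j) ∧ ∀ g ∈ C, (D.act j g).hom.edgeMap e = e := by
  rcases SemiGraph.adjacent_or_exists_fixedBranchPairSystem_of_bounded_dist C D.tree D.isTree D.act
      D.trans x x' hx hx' (fun j γ => hfx γ.1 γ.2 j) (fun j γ => hfx' γ.1 γ.2 j) hbdd with hadj | hsys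
  · obtain ⟨e, b, b', hbb, hbe, hb'e, hbx, hb'x, hfix⟩ := hadj j hne
    exact ⟨e, b, b', hbb, hbe, hb'e, hbx, hb'x, fun g hg => hfix ⟨g, hg⟩⟩
  · obtain ⟨j₀, w, β, β', hpair, hcompat, hfix⟩ := hsys
    exact absurd (SemiGraph.eq_bot_of_fixedSubjointSystem C D.tree D.act D.trans level levelAct quot
      quot_isImmersion act_quot levelTrans trans_quot hnobp j₀ w β β' hpair hcompat hfix) hC

/-- **`hadj` at bounded distance from the compact-form branch-level identification (I4′)_cpt at the
levels** ([SemiAnbd] Thm. 3.7 (iii), p. 41): with the same level structure, if (I4′)_cpt holds for `C` at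
the levels (`stabC` — the stabiliser of a compatible level branch-pair system lies, after a homomorphism
injective on `C`, in two distinct branch-conjugates; the shape delivered by the Galois tower), then total
estrangement kills every compatible `C`-fixed branch-pair system of the trees
(`noFixedTreeBranchPairSystem_of_stabBranchPairCpt_level`, abc-iut-w4-d080) and the bounded-distance
adjacency `hadj_of_bounded_dist` (abc-iut-w5-d160) applies.  No finiteness of the levels.
[cite: MochizukiSemiAnbd2006, Thm 3.7(iii) p.41] -/
theorem hadj_of_bounded_dist_of_stabBranchPairCpt_level (h𝒢 : 𝒢.Thm37Hypotheses)
    (C : Subgroup c.G) (hC : C ≠ ⊥)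
    (level : D.J → SemiGraph.{u}) (quot : ∀ j, D.tree j ⟶ level j)
    (quot_isImmersion : ∀ j, SemiGraph.IsImmersion (quot j)) (levelAct : ∀ j, c.G →* Aut (level j))
    (act_quot : ∀ (j : D.J) (g : c.G), (D.act j g).hom ≫ quot j = quot j ≫ (levelAct j g).hom)
    (levelTrans : ∀ ⦃i j : D.J⦄, i ≤ j → (level j ⟶ level i))
    (trans_quot : ∀ ⦃i j : D.J⦄ (h : i ≤ j), D.trans h ≫ quot i = quot j ≫ levelTrans h)
    (stabC : ∀ (j₀ : D.J) (w : ∀ i : {i : D.J // j₀ ≤ i}, (level i.1).Vertex)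
      (β β' : ∀ i : {i : D.J // j₀ ≤ i}, (level i.1).Branch),
      (∀ i, β i ≠ β' i ∧ (level i.1).abuts (β i) = some (w i) ∧ (level i.1).abuts (β' i) = some (w i)) →
      (∀ ⦃i i' : {i : D.J // j₀ ≤ i}⦄ (h : i.1 ≤ i'.1), (levelTrans h).vertexMap (w i') = w i ∧
        (levelTrans h).branchMap (β i') = β i ∧ (levelTrans h).branchMap (β' i') = β' i) →
      ∃ (Q : Type u) (_ : Group Q) (ιQ : c.G →* Q) (v : 𝒢.graph.Vertex) (b b' : 𝒢.graph.Branch)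
        (hb : 𝒢.graph.abuts b = some v) (hb' : 𝒢.graph.abuts b' = some v) (ψ : 𝒢.Gv v →* Q)
        (y y' : 𝒢.Gv v),
        Set.InjOn ιQ C ∧ Function.Injective ψ ∧ (b' ≠ b ∨ y⁻¹ * y' ∉ 𝒢.branchSubgroup b v hb) ∧
        ∀ g ∈ C, (∀ i, (levelAct i.1 g).hom.vertexMap (w i) = w i ∧
          (levelAct i.1 g).hom.branchMap (β i) = β i ∧ (levelAct i.1 g).hom.branchMap (β' i) = β' i) →
          ιQ g ∈ ((𝒢.branchSubgroup b v hb).map (MulAut.conj y).toMonoidHom).map ψ ⊓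
            ((𝒢.branchSubgroup b' v hb').map (MulAut.conj y').toMonoidHom).map ψ)
    (x x' : ∀ j, (D.tree j).Vertex)
    (hx : ∀ ⦃i j : D.J⦄ (h : i ≤ j), (D.trans h).vertexMap (x j) = x i)
    (hx' : ∀ ⦃i j : D.J⦄ (h : i ≤ j), (D.trans h).vertexMap (x' j) = x' i)
    (hfx : ∀ g ∈ C, ∀ j, (D.act j g).hom.vertexMap (x j) = x j)
    (hfx' : ∀ g ∈ C, ∀ j, (D.act j g).hom.vertexMap (x' j) = x' j)
    (hbdd : ∃ N : ℕ, ∀ j, (D.tree j).subdivision.dist (Sum.inl (x j)) (Sum.inl (x' j)) ≤ N)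
    (j : D.J) (hne : x j ≠ x' j) :
    ∃ (e : (D.tree j).Edge) (b b' : (D.tree j).Branch), b ≠ b' ∧
      (D.tree j).edgeOf b = e ∧ (D.tree j).edgeOf b' = e ∧ (D.tree j).abuts b = some (x j) ∧
      (D.tree j).abuts b' = some (x' j) ∧ ∀ g ∈ C, (D.act j g).hom.edgeMap e = e :=
  D.hadj_of_bounded_dist C hC
    (D.noFixedTreeBranchPairSystem_of_stabBranchPairCpt_level h𝒢 C level quot quot_isImmersion
      levelAct act_quot levelTrans trans_quot stabC)
    x x' hx hx' hfx hfx' hbdd j hne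

end VerticialLevelData

/-- **`hadj` at bounded distance for the CANONICAL tower of the constructed chart** ([SemiAnbd]
Thm. 3.7 (iii), p. 41, beyond finite semi-graphs): for `𝒢` satisfying the hypotheses of Thm. 3.7 and the
level data `verticialLevelData_temperedPiChart h36` (trees `𝔾̃_n` of the Galois tower of Prop. 3.6, acted
on by `π₁^temp(𝒢)`), the levels are the orbit graphs `𝔾_{S n}`, `treeQuot n : 𝔾̃_n → 𝔾_{S n}` the
universal graph-coverings; modulo the compact-form branch-level identification (I4′)_cpt at these levels
(`stabC`, produced finiteness-free by the tower, abc-iut-L3-t11's `stabBranchPairCpt'_ofTower'`), every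
nontrivial compact `C ≤ π₁^temp(𝒢)` and compatible `C`-fixed vertex systems at bounded distance are
adjacent through a `C`-fixed edge wherever they differ — the `Hadj` binder of
`compactInVerticialAt_of_fixedSystems` in the bounded case, for ANY countable `𝒢`.
[cite: MochizukiSemiAnbd2006, Thm 3.7(iii) p.41] -/
theorem hadj_temperedPiChart_of_bounded_dist (h37 : 𝒢.Thm37Hypotheses)
    (stabC : ∀ (C : Subgroup (𝒢.temperedPiChart h37.toProp36Hypotheses).G),
      IsCompact (C : Set (𝒢.temperedPiChart h37.toProp36Hypotheses).G) →
      ∀ (j₀ : ℕ) (w : ∀ i : {i : ℕ // j₀ ≤ i},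
        ((𝒢.galoisLevelData h37.toProp36Hypotheses).S i.1).orbitGraph.Vertex)
      (β β' : ∀ i : {i : ℕ // j₀ ≤ i},
        ((𝒢.galoisLevelData h37.toProp36Hypotheses).S i.1).orbitGraph.Branch),
      (∀ i, β i ≠ β' i ∧
        ((𝒢.galoisLevelData h37.toProp36Hypotheses).S i.1).orbitGraph.abuts (β i) = some (w i) ∧
        ((𝒢.galoisLevelData h37.toProp36Hypotheses).S i.1).orbitGraph.abuts (β' i) = some (w i)) →
      (∀ ⦃i i' : {i : ℕ // j₀ ≤ i}⦄ (h : i.1 ≤ i'.1),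
        ((𝒢.galoisLevelData h37.toProp36Hypotheses).levelTrans h).vertexMap (w i') = w i ∧
        ((𝒢.galoisLevelData h37.toProp36Hypotheses).levelTrans h).branchMap (β i') = β i ∧
        ((𝒢.galoisLevelData h37.toProp36Hypotheses).levelTrans h).branchMap (β' i') = β' i) →
      ∃ (Q : Type u) (_ : Group Q) (ιQ : (𝒢.temperedPiChart h37.toProp36Hypotheses).G →* Q)
        (v : 𝒢.graph.Vertex) (b b' : 𝒢.graph.Branch)
        (hb : 𝒢.graph.abuts b = some v) (hb' : 𝒢.graph.abuts b' = some v) (ψ : 𝒢.Gv v →* Q)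
        (y y' : 𝒢.Gv v),
        Set.InjOn ιQ C ∧ Function.Injective ψ ∧ (b' ≠ b ∨ y⁻¹ * y' ∉ 𝒢.branchSubgroup b v hb) ∧
        ∀ g ∈ C, (∀ i,
          ((𝒢.galoisLevelData h37.toProp36Hypotheses).levelAct h37.isCountable
            (𝒢.galoisLevelData_hconn h37.toProp36Hypotheses) i.1 g).hom.vertexMap (w i) = w i ∧
          ((𝒢.galoisLevelData h37.toProp36Hypotheses).levelAct h37.isCountable
            (𝒢.galoisLevelData_hconn h37.toProp36Hypotheses) i.1 g).hom.branchMap (β i) = β i ∧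
          ((𝒢.galoisLevelData h37.toProp36Hypotheses).levelAct h37.isCountable
            (𝒢.galoisLevelData_hconn h37.toProp36Hypotheses) i.1 g).hom.branchMap (β' i) = β' i) →
          ιQ g ∈ ((𝒢.branchSubgroup b v hb).map (MulAut.conj y).toMonoidHom).map ψ ⊓
            ((𝒢.branchSubgroup b' v hb').map (MulAut.conj y').toMonoidHom).map ψ)
    (C : Subgroup (𝒢.temperedPiChart h37.toProp36Hypotheses).G)
    (hCcpt : IsCompact (C : Set (𝒢.temperedPiChart h37.toProp36Hypotheses).G)) (hC : C ≠ ⊥)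
    (x x' : ∀ j, ((verticialLevelData_temperedPiChart (h36 := h37.toProp36Hypotheses)).tree j).Vertex)
    (hx : ∀ ⦃i j : ℕ⦄ (h : i ≤ j),
      ((verticialLevelData_temperedPiChart (h36 := h37.toProp36Hypotheses)).trans h).vertexMap (x j) =
        x i)
    (hx' : ∀ ⦃i j : ℕ⦄ (h : i ≤ j),
      ((verticialLevelData_temperedPiChart (h36 := h37.toProp36Hypotheses)).trans h).vertexMap (x' j) =
        x' i)
    (hfx : ∀ g ∈ C, ∀ j,
      ((verticialLevelData_temperedPiChart (h36 := h37.toProp36Hypotheses)).act j g).hom.vertexMap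
        (x j) = x j)
    (hfx' : ∀ g ∈ C, ∀ j,
      ((verticialLevelData_temperedPiChart (h36 := h37.toProp36Hypotheses)).act j g).hom.vertexMap
        (x' j) = x' j)
    (hbdd : ∃ N : ℕ, ∀ j,
      ((verticialLevelData_temperedPiChart (h36 := h37.toProp36Hypotheses)).tree j).subdivision.dist
        (Sum.inl (x j)) (Sum.inl (x' j)) ≤ N)
    (j : ℕ) (hne : x j ≠ x' j) :
    ∃ (e : ((verticialLevelData_temperedPiChart (h36 := h37.toProp36Hypotheses)).tree j).Edge)
      (b b' : ((verticialLevelData_temperedPiChart (h36 := h37.toProp36Hypotheses)).tree j).Branch),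
      b ≠ b' ∧
      ((verticialLevelData_temperedPiChart (h36 := h37.toProp36Hypotheses)).tree j).edgeOf b = e ∧
      ((verticialLevelData_temperedPiChart (h36 := h37.toProp36Hypotheses)).tree j).edgeOf b' = e ∧
      ((verticialLevelData_temperedPiChart (h36 := h37.toProp36Hypotheses)).tree j).abuts b =
        some (x j) ∧
      ((verticialLevelData_temperedPiChart (h36 := h37.toProp36Hypotheses)).tree j).abuts b' =
        some (x' j) ∧
      ∀ g ∈ C,
        ((verticialLevelData_temperedPiChart (h36 := h37.toProp36Hypotheses)).act j g).hom.edgeMap e =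
          e := by
  let h36 := h37.toProp36Hypotheses
  let G := 𝒢.galoisLevelData h36
  exact (verticialLevelData_temperedPiChart (h36 := h36)).hadj_of_bounded_dist_of_stabBranchPairCpt_level
    h37 C hC (fun n => (G.S n).orbitGraph) (fun n => G.treeQuot n) (fun n => G.treeQuot_isImmersion n)
    (fun n => (G.levelAct h36.isCountable (𝒢.galoisLevelData_hconn h36) n).comp (MonoidHom.id _))
    (fun n g => G.treeQuot_act h36.isCountable (𝒢.galoisLevelData_hconn h36) n g)
    (fun _ _ h => G.levelTrans h) (fun _ _ h => G.treeTrans_quot h)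
    (fun j₀ w β β' hpair hcompat => stabC C hCcpt j₀ w β β' hpair hcompat) x x' hx hx' hfx hfx' hbdd j hne

end ProfiniteSemiGraph

end Literature.AnabelianGeometry.SemiGraphs
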